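import Mathlib

/-!
# Route `SignedLowerHalves`, crux `KobayashiLowerHalfSemistable` (item stmt-BirchSwinnertonDyer-19000): the
# LATTICE ALGEBRA on which bstw-MEMO-11's Theorems A/B run — the sign lattices `𝕃^±` of BSTW I
# Lemmas 3.14–3.15 as used in MEMO-11 (F3): classification, `ν`-table, `T_v`-chain, descent step
# (cell `bsd-ssimc`, seat `bsd-ssimc-k3-c2` gen 12, object «SIGN-LATTICES», planner ruling D23-5;
# a `--supports stmt-BirchSwinnertonDyer-19000 --as helper` file: closes nothing)

PARTITION (cell bsd-ssimc): X6 ∧ r = 0 (A6) × the 12 cells at `p = 3` + X6 r1 @ 3 + D2 literal @ 3 —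
types-the-object-of (the commutative algebra inside the cell's `p = 3` reading of Burungale–Skinner–Tian–Wan,
arXiv:2409.01350 (BSTW), Part I Thm. 1.3 on semistable curves: bstw-MEMO-11, which takes the residual
(3-ii)♭′ off the critical path); closes NONE; nothing booked. HONEST FRAMING: pure commutative algebra
(submodules of `R × R` over a commutative ring `R`, Mathlib only, sorry-free); NOT MEMO-11's Theorems A/B/C
themselves (their Galois-cohomological steps — Lemma K, (F4)–(F6) — have no Mathlib vocabulary), NOT B1, NOT a
binder, NO tier change; crux 2 kernel state p441716 (`KobayashiLowerHalfSemistable_of_tiersS_S3`) and the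
wording of record («(3-ii)♭′ + B1») are untouched; nothing about modular curves, Hida families or elliptic
curves is asserted; BSD is not proved by any of this.

Source: `run/shared/lean/pub/bsd-ssimc/bstw-MEMO-11.md` (sha16 cb85d30b99168706) §1 (F3), §3 (Theorem A: Cases
`D_v = 1` / `D_v = T_v`, Remark (d)), §4 (Theorem B's chain), §8 shards (S1), (S3). SYMBOL DICTIONARY (memo ↔
this file; ring letters as in p456967 `…Theorems.IndexTransfer`): `Λ_v = ℤ_p⟦T_v⟧` ↔ `R`, any commutative
ring, with `(t)` PRIME and `2 ∉ (t)` as explicit hypotheses `hp`, `h2` exactly where used (`Λ_v/(T_v) = ℤ_p` is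
a domain, `p` odd) · `T_v` ↔ `t : R` · for a `G_ℚ`-stable lattice `𝕃` with induced part `𝕃′ = 𝕃_v ⊕ c·𝕃_v` and
`𝕃″ = T_v⁻¹𝕃′`: the free module `𝕃″` with basis `e_v/T_v`, `e_v̄/T_v` ↔ `R × R` («`𝕃″`-coordinates»), so
`𝕃′` ↔ `t • ⊤`, `𝕃″` ↔ `⊤`, the `v`-line `𝕃″_v` ↔ `Submodule.prod ⊤ ⊥`, the `v̄`-line ↔ `Submodule.prod ⊥ ⊤`,
`𝕃″ → 𝕃″⁻ = 𝕃″/𝕃″_v` ↔ `LinearMap.snd R R R` · complex conjugation `c` (`e_v ↔ e_v̄`) ↔ the swap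
`x ↦ (x.2, x.1)` · `σ ∈ G_L` acting by `(Ψ(σ), Ψ^c(σ))`, `Ψ ≡ Ψ^c ≡ 1 mod T_v` ↔ `x ↦ (u₁ x.1, u₂ x.2)` with
`t ∣ u₁ - 1`, `t ∣ u₂ - 1` · `𝕃^± = 𝕃′ + Λ_v (e_v ± e_v̄)/T_v` ↔ `t • ⊤ ⊔ R ∙ (1, ±1)` · Lemma 3.14(ii) AS USED
in (F3) («both quotients `≅ Λ_v/T_v = ℤ_p`», so every `s ∉ (T_v)` acts injectively on `𝕃″/𝕃`) ↔ `L` is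
`(t)`-SATURATED (`¬ t ∣ s`, `s • x ∈ L` ⟹ `x ∈ L`) · `ν` of MEMO-11 (F6)/Lemma V ↔ image under `LinearMap.snd`
(`⊤`: `ν = 0` relative to `𝕃″⁻`; `(t)`: one `T_v` smaller).

WHAT IS KERNEL-CHECKED. HEADLINE (§3) **CLASSIFICATION = shard (S1) at lattice level**
`eq_of_swap_stable_of_saturated`: a swap-stable `(t)`-saturated `L ≥ t • ⊤` is one of `t • ⊤`, `𝕃⁺`, `𝕃⁻`, `⊤`
(elementwise, from primality of `(t)` and `2 ∉ (t)`); `eq_plus_or_eq_minus` (induced ends excluded: MEMO-11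
«`𝕋̃ ∈ {J, J⁺, J⁻}`, `ℍ̃ ∈ {I, I⁺, I⁻}`»); converses `saturated_smul_top`, `saturated_plus`; the `t = 0`
specialisation `eq_of_swap_stable_of_saturated_zero` = (S1) verbatim («the `c`-stable saturated lines of
`ℤ_pē_v ⊕ ℤ_pē_v̄` are `ℤ_p(ē_v ± ē_v̄)`, `p` odd»). §1 membership `mem_smul_top_iff`, `mem_plus_iff`
(`⟺ t ∣ x₁ - x₂`), `mem_minus_iff` (`⟺ t ∣ x₁ + x₂`). §2 (F3) «both signs ARE `G_ℚ`-stable»: `swap_mem_plus/minus`,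
`diag_mem_plus/minus`. §4 Lemma 3.15(ii)(iii): `plus_inf_fst_axis` (`𝕃_v = T_v𝕃″_v`), `map_snd_plus/minus`
(`(𝕃^±)⁻ = 𝕃″⁻`: `ν = 0`, fed to Lemma V in all three cases of Theorem A), `map_snd_smul_top` (`ν = 1` for the
induced `T_v𝕃″`, Remark (d)), `plus_ne_inf_sup_inf` (`𝕃⁺` is NOT induced). §5 Theorem A, Case `D_v = 1`:
`smul_top_lt_plus/minus` (`J ⊊ J^±`), `plus_lt_top`, `not_plus_le_minus`, `not_minus_le_plus` (`J^∓ ⊉ J^±`),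
`eq_of_plus_le` (`J⁺ ≤ ℍ̃ ∈ {J, J⁺, J⁻}` ⟹ `ℍ̃ = J⁺`; the sign `-` is symmetric). §6 the chain of (F3)/Theorem B:
`smul_le_smul_top`, `smul_smul_le_smul_smul_top` (`T_v²·ℍ̃ ⊆ T_v·I`). §7 shard (S3): `descent_step`. NOT typed:
(S2) (powers of `T_v` in `Frac Λ_v`, content-free), Lemma K, (F4)–(F6), B1. References: BSTW arXiv:2409.01350v2
I Lemmas 3.14, 3.15, 3.18, Prop. 4.21, Thm. 5.22. Design: THEOREMS ONLY (no def/structure/instance/notation/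
named fact); sign-`-` twins of `saturated_plus` / `plus_inf_fst_axis` / `plus_lt_top` / `eq_of_plus_le` are the
same proofs with `x₁ + x₂` and are omitted for the 400-line cap.
-/

open Pointwise

-- lint debt, justified: the Theorems namespace repeats the summit name (D-0017); `dupNamespace` flags every decl.
set_option linter.dupNamespace false

namespace Summit.BirchSwinnertonDyer.BirchSwinnertonDyer.Theorems.SignLattices

variable {R : Type*} [CommRing R]

/-! ## §1 Membership in the lattices `𝕃′ = t • ⊤`, `𝕃⁺`, `𝕃⁻` (`𝕃″`-coordinates) -/

/-- The induced lattice `𝕃′ = T_v·𝕃″`: `x ∈ t • ⊤ ⟺ t ∣ x₁ ∧ t ∣ x₂`. -/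
theorem mem_smul_top_iff (t : R) (x : R × R) :
    x ∈ t • (⊤ : Submodule R (R × R)) ↔ t ∣ x.1 ∧ t ∣ x.2 := by
  rw [Submodule.mem_smul_pointwise_iff_exists]
  constructor
  · rintro ⟨y, -, rfl⟩
    exact ⟨⟨y.1, by simp⟩, ⟨y.2, by simp⟩⟩
  · rintro ⟨⟨a, ha⟩, ⟨b, hb⟩⟩
    exact ⟨(a, b), Submodule.mem_top, by ext <;> simp [ha, hb]⟩

/-- The sign lattice `𝕃⁺ = 𝕃′ + Λ_v·(e_v + e_v̄)/T_v`: `x ∈ t • ⊤ ⊔ R ∙ (1, 1) ⟺ t ∣ x₁ - x₂`. -/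
theorem mem_plus_iff (t : R) (x : R × R) : x ∈ t • ⊤ ⊔ (R ∙ ((1 : R), (1 : R))) ↔ t ∣ x.1 - x.2 := by
  constructor
  · intro hx
    obtain ⟨y, hy, z, hz, rfl⟩ := Submodule.mem_sup.1 hx
    obtain ⟨a, rfl⟩ := Submodule.mem_span_singleton.1 hz
    obtain ⟨⟨c, hc⟩, ⟨d, hd⟩⟩ := (mem_smul_top_iff t y).1 hy
    have h1 : (y + a • ((1 : R), (1 : R))).1 = t * c + a := by simp [hc]
    have h2 : (y + a • ((1 : R), (1 : R))).2 = t * d + a := by simp [hd]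
    exact ⟨c - d, by rw [h1, h2]; ring⟩
  · rintro ⟨c, hc⟩
    refine Submodule.mem_sup.2 ⟨(x.1 - x.2, 0), (mem_smul_top_iff t _).2 ⟨⟨c, hc⟩, ⟨0, by simp⟩⟩,
      x.2 • ((1 : R), (1 : R)), Submodule.mem_span_singleton.2 ⟨x.2, rfl⟩, ?_⟩
    ext <;> simp

/-- The sign lattice `𝕃⁻ = 𝕃′ + Λ_v·(e_v - e_v̄)/T_v`: `x ∈ t • ⊤ ⊔ R ∙ (1, -1) ⟺ t ∣ x₁ + x₂`. -/
theorem mem_minus_iff (t : R) (x : R × R) : x ∈ t • ⊤ ⊔ (R ∙ ((1 : R), (-1 : R))) ↔ t ∣ x.1 + x.2 := by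
  constructor
  · intro hx
    obtain ⟨y, hy, z, hz, rfl⟩ := Submodule.mem_sup.1 hx
    obtain ⟨a, rfl⟩ := Submodule.mem_span_singleton.1 hz
    obtain ⟨⟨c, hc⟩, ⟨d, hd⟩⟩ := (mem_smul_top_iff t y).1 hy
    have h1 : (y + a • ((1 : R), (-1 : R))).1 = t * c + a := by simp [hc]
    have h2 : (y + a • ((1 : R), (-1 : R))).2 = t * d - a := by simp [hd, sub_eq_add_neg]
    exact ⟨c + d, by rw [h1, h2]; ring⟩
  · rintro ⟨c, hc⟩
    refine Submodule.mem_sup.2 ⟨(x.1 + x.2, 0), (mem_smul_top_iff t _).2 ⟨⟨c, hc⟩, ⟨0, by simp⟩⟩,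
      (-x.2) • ((1 : R), (-1 : R)), Submodule.mem_span_singleton.2 ⟨-x.2, rfl⟩, ?_⟩
    ext <;> simp

/-! ## §2 (F3) «both signs ARE `G_ℚ`-stable»: swap `c` and diagonal units `≡ 1 mod t` (trivial for `t • ⊤`, `⊤`) -/

/-- `𝕃⁺` is swap-stable (`c` preserves `𝕃⁺`). -/
theorem swap_mem_plus {t : R} {x : R × R} (hx : x ∈ t • ⊤ ⊔ (R ∙ ((1 : R), (1 : R)))) :
    (x.2, x.1) ∈ t • ⊤ ⊔ (R ∙ ((1 : R), (1 : R))) := by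
  rw [mem_plus_iff] at hx ⊢
  exact (dvd_sub_comm).1 hx

/-- `𝕃⁻` is swap-stable. -/
theorem swap_mem_minus {t : R} {x : R × R} (hx : x ∈ t • ⊤ ⊔ (R ∙ ((1 : R), (-1 : R)))) :
    (x.2, x.1) ∈ t • ⊤ ⊔ (R ∙ ((1 : R), (-1 : R))) := by
  rw [mem_minus_iff] at hx ⊢
  simpa [add_comm] using hx

/-- `𝕃⁺` is stable under the diagonal action of `(u₁, u₂)` with `u₁ ≡ u₂ ≡ 1 (mod t)` — the model of
`Ψ(σ) - 1, Ψ^c(σ) - 1 ∈ (T_v)` for `σ ∈ G_L` (MEMO-11 (F3): «both signs ARE `G_ℚ`-stable»). -/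
theorem diag_mem_plus {t u₁ u₂ : R} (hu₁ : t ∣ u₁ - 1) (hu₂ : t ∣ u₂ - 1) {x : R × R}
    (hx : x ∈ t • ⊤ ⊔ (R ∙ ((1 : R), (1 : R)))) : (u₁ * x.1, u₂ * x.2) ∈ t • ⊤ ⊔ (R ∙ ((1 : R), (1 : R))) := by
  rw [mem_plus_iff] at hx ⊢
  obtain ⟨⟨a, ha⟩, ⟨b, hb⟩, ⟨c, hc⟩⟩ := And.intro hu₁ (And.intro hu₂ hx)
  exact ⟨a * x.1 - b * x.2 + c, by linear_combination x.1 * ha - x.2 * hb + hc⟩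

/-- `𝕃⁻` is stable under the diagonal action of `(u₁, u₂)` with `u₁ ≡ u₂ ≡ 1 (mod t)`. -/
theorem diag_mem_minus {t u₁ u₂ : R} (hu₁ : t ∣ u₁ - 1) (hu₂ : t ∣ u₂ - 1) {x : R × R}
    (hx : x ∈ t • ⊤ ⊔ (R ∙ ((1 : R), (-1 : R)))) : (u₁ * x.1, u₂ * x.2) ∈ t • ⊤ ⊔ (R ∙ ((1 : R), (-1 : R))) := by
  rw [mem_minus_iff] at hx ⊢
  obtain ⟨⟨a, ha⟩, ⟨b, hb⟩, ⟨c, hc⟩⟩ := And.intro hu₁ (And.intro hu₂ hx)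
  exact ⟨a * x.1 + b * x.2 + c, by linear_combination x.1 * ha + x.2 * hb + hc⟩

/-! ## §3 HEADLINE: classification of the swap-stable saturated lattices between `t • ⊤` and `⊤` (shard (S1)) -/

/-- `(t)` prime, elementwise: `t ∣ a b ⟹ t ∣ a ∨ t ∣ b`. -/
theorem dvd_or_dvd {t : R} (hp : (Ideal.span {t}).IsPrime) {a b : R} (h : t ∣ a * b) : t ∣ a ∨ t ∣ b := by
  simpa only [Ideal.mem_span_singleton] using hp.mem_or_mem (Ideal.mem_span_singleton.2 h)

/-- If a swap-stable submodule of `R × R` contains `(1, 0)`, it is everything. -/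
theorem eq_top_of_mem {L : Submodule R (R × R)} (hswap : ∀ x ∈ L, (x.2, x.1) ∈ L)
    (h10 : ((1 : R), (0 : R)) ∈ L) : L = ⊤ := by
  refine eq_top_iff.2 fun x _ => ?_
  convert L.add_mem (L.smul_mem x.1 h10) (L.smul_mem x.2 (hswap _ h10)) using 1
  ext <;> simp

/-- Saturation in action: `(a, 0) ∈ L` with `¬ t ∣ a` forces `(1, 0) ∈ L`. -/
theorem one_zero_mem_of_mem {t : R} {L : Submodule R (R × R)}
    (hsat : ∀ (s : R) (x : R × R), ¬ t ∣ s → s • x ∈ L → x ∈ L) {a : R} (ha : ¬ t ∣ a)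
    (hmem : (a, (0 : R)) ∈ L) : ((1 : R), (0 : R)) ∈ L := by
  refine hsat a _ ha ?_
  convert hmem using 1
  ext <;> simp

/-- **HEADLINE — Classification of the sign lattices (bstw-MEMO-11 §1 (F3) = BSTW I Lemmas 3.14–3.15 in the
model; shard (S1) at lattice level).** Let `(t)` be prime with `2 ∉ (t)` (`Λ_v/(T_v) = ℤ_p`, `p` odd). A
swap-stable (`c`-stable) submodule `L` of `R × R = 𝕃″` with `t • ⊤ = 𝕃′ ≤ L` which is `(t)`-SATURATED (`¬ t ∣ s`,
`s • x ∈ L` ⟹ `x ∈ L`: every `s ∉ (T_v)` acts injectively on `𝕃″/𝕃` — EXACTLY how Lemma 3.14(ii) is USED in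
MEMO-11 §1 (F3), bracket «Lemma 3.14(ii) gives `𝕃′ ⊊ 𝕃 ⊊ 𝕃″ = T_v⁻¹𝕃′` with both quotients `≅ Λ_v/T_v = ℤ_p`;
`𝕃/𝕃′` is then a `c`-stable saturated `ℤ_p`-line in `𝕃″/𝕃′ = ℤ_pē_v ⊕ ℤ_pē_v̄` … so the line is `ℤ_p(ē_v ± ē_v̄)`»,
consumed at §3 Theorem A, proof l.1 «By (F3), `𝕋̃ = J^ε` for a sign `ε`» and §4 Theorem B, proof l.1) is one of
`t • ⊤ = 𝕃′`, `𝕃⁺`, `𝕃⁻`, `⊤ = 𝕃″`. Proof: for `x = (a, b) ∈ L`, `(a + b)·(1,1)`, `(a - b)·(1,-1) ∈ L` by the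
swap; saturation turns a non-divisible coefficient into `(1, ±1) ∈ L`; both signs give `(2,0)`, `(1,0)`, `⊤`;
neither gives `t ∣ 2a, 2b`, hence `t • ⊤`. Only `c` and saturation are used (not `G_L`), as in MEMO-11. -/
theorem eq_of_swap_stable_of_saturated {t : R} (hp : (Ideal.span {t}).IsPrime) (h2 : ¬ t ∣ 2)
    {L : Submodule R (R × R)} (hswap : ∀ x ∈ L, (x.2, x.1) ∈ L) (hle : t • ⊤ ≤ L)
    (hsat : ∀ (s : R) (x : R × R), ¬ t ∣ s → s • x ∈ L → x ∈ L) :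
    L = t • ⊤ ∨ L = t • ⊤ ⊔ (R ∙ ((1 : R), (1 : R))) ∨ L = t • ⊤ ⊔ (R ∙ ((1 : R), (-1 : R))) ∨ L = ⊤ := by
  -- the two test vectors `(1, 1)` and `(1, -1)`
  by_cases hP : ((1 : R), (1 : R)) ∈ L
  · by_cases hM : ((1 : R), (-1 : R)) ∈ L
    · -- both signs: `(2, 0) ∈ L`, so `(1, 0) ∈ L`, so `L = ⊤`
      refine Or.inr (Or.inr (Or.inr (eq_top_of_mem hswap (one_zero_mem_of_mem hsat h2 ?_))))
      convert L.add_mem hP hM using 1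
      ext <;> norm_num
    · -- `(1,1) ∈ L`, `(1,-1) ∉ L`: `L = 𝕃⁺`
      refine Or.inr (Or.inl (le_antisymm ?_ (sup_le hle ((Submodule.span_singleton_le_iff_mem _ _).2 hP))))
      intro x hx
      rw [mem_plus_iff]
      by_contra hnd
      have hx' : (x.1 - x.2, (0 : R)) ∈ L := by
        convert L.sub_mem hx (L.smul_mem x.2 hP) using 1
        ext <;> simp
      have h10 := one_zero_mem_of_mem hsat hnd hx'
      refine hM ?_
      convert L.sub_mem h10 (hswap _ h10) using 1
      ext <;> simp
  · by_cases hM : ((1 : R), (-1 : R)) ∈ L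
    · -- `(1,1) ∉ L`, `(1,-1) ∈ L`: `L = 𝕃⁻`
      refine Or.inr (Or.inr (Or.inl
        (le_antisymm ?_ (sup_le hle ((Submodule.span_singleton_le_iff_mem _ _).2 hM)))))
      intro x hx
      rw [mem_minus_iff]
      by_contra hnd
      have hx' : (x.1 + x.2, (0 : R)) ∈ L := by
        convert L.add_mem hx (L.smul_mem x.2 hM) using 1
        ext <;> simp
      have h10 := one_zero_mem_of_mem hsat hnd hx'
      refine hP ?_
      convert L.add_mem h10 (hswap _ h10) using 1
      ext <;> simp
    · -- neither sign: `L = t • ⊤`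
      refine Or.inl (le_antisymm (fun x hx => ?_) hle)
      have hsum : t ∣ x.1 + x.2 := by
        by_contra hnd
        refine hP (hsat (x.1 + x.2) _ hnd ?_)
        convert L.add_mem hx (hswap _ hx) using 1
        ext <;> simp [add_comm]
      have hdiff : t ∣ x.1 - x.2 := by
        by_contra hnd
        refine hM (hsat (x.1 - x.2) _ hnd ?_)
        convert L.sub_mem hx (hswap _ hx) using 1
        ext <;> simp [sub_eq_add_neg]
      have h2a : t ∣ 2 * x.1 := by
        rw [show 2 * x.1 = x.1 + x.2 + (x.1 - x.2) by ring]
        exact dvd_add hsum hdiff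
      have h2b : t ∣ 2 * x.2 := by
        rw [show 2 * x.2 = x.1 + x.2 - (x.1 - x.2) by ring]
        exact dvd_sub hsum hdiff
      exact (mem_smul_top_iff t x).2 ⟨(dvd_or_dvd hp h2a).resolve_left h2, (dvd_or_dvd hp h2b).resolve_left h2⟩

/-- The classification with the two induced ends excluded: a NON-induced swap-stable saturated lattice
strictly between `t • ⊤` and `⊤` is `𝕃⁺` or `𝕃⁻` (MEMO-11 (F3): «`𝕋̃ ∈ {J, J⁺, J⁻}`, `ℍ̃ ∈ {I, I⁺, I⁻}`»;
Theorem A: «Suppose not. By (F3), `𝕋̃ = J^ε` for a sign `ε`»). -/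
theorem eq_plus_or_eq_minus {t : R} (hp : (Ideal.span {t}).IsPrime) (h2 : ¬ t ∣ 2)
    {L : Submodule R (R × R)} (hswap : ∀ x ∈ L, (x.2, x.1) ∈ L) (hle : t • ⊤ ≤ L)
    (hsat : ∀ (s : R) (x : R × R), ¬ t ∣ s → s • x ∈ L → x ∈ L) (hbot : L ≠ t • ⊤) (htop : L ≠ ⊤) :
    L = t • ⊤ ⊔ (R ∙ ((1 : R), (1 : R))) ∨ L = t • ⊤ ⊔ (R ∙ ((1 : R), (-1 : R))) := by
  rcases eq_of_swap_stable_of_saturated hp h2 hswap hle hsat with h | h | h | h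
  exacts [(hbot h).elim, Or.inl h, Or.inr h, (htop h).elim]

/-- Converse, induced case: `t • ⊤` is `(t)`-saturated when `(t)` is prime. -/
theorem saturated_smul_top {t : R} (hp : (Ideal.span {t}).IsPrime) (s : R) (x : R × R) (hs : ¬ t ∣ s)
    (hx : s • x ∈ t • (⊤ : Submodule R (R × R))) : x ∈ t • (⊤ : Submodule R (R × R)) := by
  rw [mem_smul_top_iff] at hx ⊢
  simp only [Prod.smul_fst, Prod.smul_snd, smul_eq_mul] at hx
  exact ⟨(dvd_or_dvd hp hx.1).resolve_left hs, (dvd_or_dvd hp hx.2).resolve_left hs⟩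

/-- Converse, sign `+`: `𝕃⁺` is `(t)`-saturated when `(t)` is prime. -/
theorem saturated_plus {t : R} (hp : (Ideal.span {t}).IsPrime) (s : R) (x : R × R) (hs : ¬ t ∣ s)
    (hx : s • x ∈ t • ⊤ ⊔ (R ∙ ((1 : R), (1 : R)))) : x ∈ t • ⊤ ⊔ (R ∙ ((1 : R), (1 : R))) := by
  rw [mem_plus_iff] at hx ⊢
  simp only [Prod.smul_fst, Prod.smul_snd, smul_eq_mul, ← mul_sub] at hx
  exact (dvd_or_dvd hp hx).resolve_left hs

/-- The `t = 0` specialisation (shard (S1) verbatim, saturated form): over a DOMAIN with `2 ≠ 0`, a swap-stable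
SATURATED submodule of `R × R` (`s ≠ 0`, `s • x ∈ N` ⟹ `x ∈ N`) is `⊥`, `R·(1,1)`, `R·(1,-1)` or `⊤` — «the
`c`-stable saturated lines of `ℤ_pē_v ⊕ ℤ_pē_v̄` are `ℤ_p(ē_v ± ē_v̄)`, `p` odd» (MEMO-11 §8 (S1)). -/
theorem eq_of_swap_stable_of_saturated_zero [IsDomain R] (h2 : (2 : R) ≠ 0) {N : Submodule R (R × R)}
    (hswap : ∀ x ∈ N, (x.2, x.1) ∈ N) (hsat : ∀ (s : R) (x : R × R), s ≠ 0 → s • x ∈ N → x ∈ N) :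
    N = ⊥ ∨ N = R ∙ ((1 : R), (1 : R)) ∨ N = R ∙ ((1 : R), (-1 : R)) ∨ N = ⊤ := by
  have h0 : (0 : R) • (⊤ : Submodule R (R × R)) = ⊥ := by
    ext x
    simp only [mem_smul_top_iff, zero_dvd_iff, Submodule.mem_bot, Prod.ext_iff, Prod.fst_zero, Prod.snd_zero]
  have hp : (Ideal.span {(0 : R)}).IsPrime := by
    rw [Ideal.span_singleton_zero]
    exact Ideal.isPrime_bot
  have h2' : ¬ (0 : R) ∣ 2 := by rwa [zero_dvd_iff]
  have := eq_of_swap_stable_of_saturated hp h2' hswap (by rw [h0]; exact bot_le)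
    (fun s x hs => hsat s x (by rwa [zero_dvd_iff] at hs))
  simpa only [h0, bot_sup_eq] using this

/-! ## §4 BSTW I Lemma 3.15 (ii)(iii) in the model: `v`-part, `ν`-table, non-inducedness (sign `-` alike) -/

/-- `𝕃⁺ ∩ 𝕍_v = T_v·𝕃″_v` (Lemma 3.15(ii): `𝕃_v = T_v 𝕃″_v` for a non-induced `𝕃`). -/
theorem plus_inf_fst_axis (t : R) :
    (t • ⊤ ⊔ (R ∙ ((1 : R), (1 : R)))) ⊓ Submodule.prod ⊤ ⊥ = Submodule.prod (Ideal.span {t}) ⊥ := by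
  ext x
  simp only [Submodule.mem_inf, mem_plus_iff, Submodule.mem_prod, Submodule.mem_top, true_and,
    Submodule.mem_bot, Ideal.mem_span_singleton]
  constructor
  · rintro ⟨h, h0⟩
    rw [h0, sub_zero] at h
    exact ⟨h, h0⟩
  · rintro ⟨h, h0⟩
    rw [h0, sub_zero]
    exact ⟨h, rfl⟩

/-- `ν = 0` for `𝕃⁺`: the image of `𝕃⁺` in `𝕃″⁻ = 𝕃″/𝕃″_v` is all of `𝕃″⁻` (Lemma 3.15(iii): `𝕃⁻ = 𝕃″⁻` as
lattices in `𝕍⁻` — the value `ν(𝕀⁻) = 0` fed to Lemma V in all three cases of MEMO-11 Theorem A). -/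
theorem map_snd_plus (t : R) : (t • ⊤ ⊔ (R ∙ ((1 : R), (1 : R)))).map (LinearMap.snd R R R) = ⊤ := by
  refine eq_top_iff.2 fun b _ => Submodule.mem_map.2 ⟨(b, b), ?_, rfl⟩
  rw [mem_plus_iff]
  simp

/-- `ν = 0` for `𝕃⁻`. -/
theorem map_snd_minus (t : R) : (t • ⊤ ⊔ (R ∙ ((1 : R), (-1 : R)))).map (LinearMap.snd R R R) = ⊤ := by
  refine eq_top_iff.2 fun b _ => Submodule.mem_map.2 ⟨(-b, b), ?_, rfl⟩
  rw [mem_minus_iff]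
  simp

/-- `ν = 1` for the induced lattice `T_v𝕃″` relative to `𝕃″⁻`: its image in `𝕃″⁻` is `(t)` (MEMO-11 §3
Remark (d): with `𝕀 = T_v⁻¹J` one has `ν(𝕀⁻) = 1` and the device yields only `T_v¹`). -/
theorem map_snd_smul_top (t : R) :
    (t • (⊤ : Submodule R (R × R))).map (LinearMap.snd R R R) = Ideal.span {t} := by
  ext b
  simp only [Submodule.mem_map, mem_smul_top_iff, LinearMap.snd_apply, Ideal.mem_span_singleton]
  exact ⟨fun ⟨x, ⟨_, hx⟩, hxb⟩ => hxb ▸ hx, fun hb => ⟨(0, b), ⟨dvd_zero t, hb⟩, rfl⟩⟩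

/-- `𝕃⁺` is NOT induced (for `t` a non-unit): the sum of its `v`- and `v̄`-parts misses `(1,1)` (Lemmas
3.14/3.15: the sign lattices are exactly the non-induced `G_ℚ`-stable lattices; `t • ⊤` and `⊤` ARE such sums). -/
theorem plus_ne_inf_sup_inf {t : R} (ht : ¬ IsUnit t) :
    (t • ⊤ ⊔ (R ∙ ((1 : R), (1 : R)))) ⊓ Submodule.prod ⊤ ⊥ ⊔
        (t • ⊤ ⊔ (R ∙ ((1 : R), (1 : R)))) ⊓ Submodule.prod ⊥ ⊤ ≠ t • ⊤ ⊔ (R ∙ ((1 : R), (1 : R))) := by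
  intro h
  have hmem : ((1 : R), (1 : R)) ∈ t • ⊤ ⊔ (R ∙ ((1 : R), (1 : R))) :=
    Submodule.mem_sup_right (Submodule.mem_span_singleton_self _)
  rw [← h] at hmem
  obtain ⟨y, hy, z, hz, hyz⟩ := Submodule.mem_sup.1 hmem
  obtain ⟨hy, hy'⟩ := Submodule.mem_inf.1 hy
  obtain ⟨-, hz'⟩ := Submodule.mem_inf.1 hz
  have hy2 : y.2 = 0 := (Submodule.mem_prod.1 hy').2
  have hz1 : z.1 = 0 := (Submodule.mem_prod.1 hz').1
  have hy1 : y.1 = 1 := by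
    have := congrArg Prod.fst hyz
    rwa [Prod.fst_add, hz1, add_zero] at this
  have h1 : t ∣ (1 : R) := by
    have := (mem_plus_iff t y).1 hy
    rwa [hy2, sub_zero, hy1] at this
  exact ht (isUnit_of_dvd_one h1)

/-! ## §5 The order facts used in MEMO-11 Theorem A, Case `D_v = 1` -/

/-- `(1, 1) ∈ t • ⊤` only if `t` is a unit; so `t • ⊤ < 𝕃⁺` for a non-unit `t` (`J ⊊ J⁺`). -/
theorem smul_top_lt_plus {t : R} (ht : ¬ IsUnit t) : t • ⊤ < t • ⊤ ⊔ (R ∙ ((1 : R), (1 : R))) := by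
  refine lt_of_le_of_ne le_sup_left fun h => ht ?_
  have hmem : ((1 : R), (1 : R)) ∈ t • (⊤ : Submodule R (R × R)) :=
    h.ge (Submodule.mem_sup_right (Submodule.mem_span_singleton_self _))
  exact isUnit_of_dvd_one ((mem_smul_top_iff t _).1 hmem).1

/-- `t • ⊤ < 𝕃⁻` for a non-unit `t` (`J ⊊ J⁻`). -/
theorem smul_top_lt_minus {t : R} (ht : ¬ IsUnit t) : t • ⊤ < t • ⊤ ⊔ (R ∙ ((1 : R), (-1 : R))) := by
  refine lt_of_le_of_ne le_sup_left fun h => ht ?_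
  have hmem : ((1 : R), (-1 : R)) ∈ t • (⊤ : Submodule R (R × R)) :=
    h.ge (Submodule.mem_sup_right (Submodule.mem_span_singleton_self _))
  exact isUnit_of_dvd_one ((mem_smul_top_iff t _).1 hmem).1

/-- `𝕃⁺ < ⊤` for a non-unit `t` (`(1, 0) ∉ 𝕃⁺`); the same proof with `mem_minus_iff` gives `𝕃⁻ < ⊤`. -/
theorem plus_lt_top {t : R} (ht : ¬ IsUnit t) : t • ⊤ ⊔ (R ∙ ((1 : R), (1 : R))) < ⊤ := by
  refine lt_top_iff_ne_top.2 fun h => ht ?_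
  have hmem : ((1 : R), (0 : R)) ∈ t • ⊤ ⊔ (R ∙ ((1 : R), (1 : R))) := h.ge Submodule.mem_top
  rw [mem_plus_iff] at hmem
  exact isUnit_of_dvd_one (by simpa using hmem)

/-- `𝕃⁺ ⊄ 𝕃⁻` when `2 ∉ (t)`: `(1,1) ∈ 𝕃⁻ ⟺ t ∣ 2` (MEMO-11 Thm A, Case `D_v = 1`: «`J^{-ε} ⊉ J^{ε}`» because
`2ε e_v̄/T_v ∉ J`). -/
theorem not_plus_le_minus {t : R} (h2 : ¬ t ∣ 2) :
    ¬ t • ⊤ ⊔ (R ∙ ((1 : R), (1 : R))) ≤ t • ⊤ ⊔ (R ∙ ((1 : R), (-1 : R))) := by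
  intro h
  have hmem := h (Submodule.mem_sup_right (Submodule.mem_span_singleton_self ((1 : R), (1 : R))))
  rw [mem_minus_iff] at hmem
  exact h2 (by simpa [one_add_one_eq_two] using hmem)

/-- `𝕃⁻ ⊄ 𝕃⁺` when `2 ∉ (t)`. -/
theorem not_minus_le_plus {t : R} (h2 : ¬ t ∣ 2) :
    ¬ t • ⊤ ⊔ (R ∙ ((1 : R), (-1 : R))) ≤ t • ⊤ ⊔ (R ∙ ((1 : R), (1 : R))) := by
  intro h
  have hmem := h (Submodule.mem_sup_right (Submodule.mem_span_singleton_self ((1 : R), (-1 : R))))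
  rw [mem_plus_iff] at hmem
  exact h2 (by simpa [sub_neg_eq_add, one_add_one_eq_two] using hmem)

/-- MEMO-11 Theorem A, Case `D_v = 1`, the lattice step: if `ℍ̃ ∈ {J, J⁺, J⁻}` contains `𝕋̃ = J⁺` then
`ℍ̃ = J⁺` («since `J ⊉ J^ε` and `J^{-ε} ⊉ J^ε`, `ℍ̃ = 𝕋̃`»). -/
theorem eq_of_plus_le {t : R} (ht : ¬ IsUnit t) (h2 : ¬ t ∣ 2) {H : Submodule R (R × R)}
    (hH : H = t • ⊤ ∨ H = t • ⊤ ⊔ (R ∙ ((1 : R), (1 : R))) ∨ H = t • ⊤ ⊔ (R ∙ ((1 : R), (-1 : R))))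
    (hle : t • ⊤ ⊔ (R ∙ ((1 : R), (1 : R))) ≤ H) : H = t • ⊤ ⊔ (R ∙ ((1 : R), (1 : R))) := by
  rcases hH with rfl | rfl | rfl
  · exact absurd (le_antisymm le_sup_left hle) (smul_top_lt_plus ht).ne
  · rfl
  · exact (not_plus_le_minus h2 hle).elim

/-! ## §6 The `T_v`-chain of (F3) / Theorem B: one `T_v` moves every lattice into the induced `T_v𝕃″` -/

/-- `t • H ≤ t • ⊤` for every `H ≤ 𝕃″`: with `t • ⊤ ≤ 𝕃^±` (`le_sup_left`) this says `t` kills both `⊤/𝕃^±`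
and `𝕃^±/t•⊤` — each step of Theorem B's chain `J ⊂ J^±`, `T_vI ⊂ I ⊂ I^±` has quotient killed by `T_v`. -/
theorem smul_le_smul_top (t : R) (H : Submodule R (R × R)) : t • H ≤ t • (⊤ : Submodule R (R × R)) := by
  intro x hx
  obtain ⟨y, -, rfl⟩ := (Submodule.mem_smul_pointwise_iff_exists x t H).1 hx
  exact Submodule.smul_mem_pointwise_smul y t ⊤ Submodule.mem_top

/-- Two steps: `t • (t • H) ≤ t • (t • ⊤)` — the model of «`T_v²·ℍ̃ ⊆ T_v·I ⊆ J`» for `ℍ̃ ∈ {I, I⁺, I⁻}` in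
`I″`-coordinates (MEMO-11 (F3) «consequently»; Theorem B: «a chain … with `k ≤ 2`»). -/
theorem smul_smul_le_smul_smul_top (t : R) (H : Submodule R (R × R)) :
    t • (t • H) ≤ t • (t • (⊤ : Submodule R (R × R))) := by
  intro x hx
  obtain ⟨y, hy, rfl⟩ := (Submodule.mem_smul_pointwise_iff_exists x t (t • H)).1 hx
  exact Submodule.smul_mem_pointwise_smul y t _ (smul_le_smul_top t H hy)

/-! ## §7 Shard (S3): the descent step of Theorem B -/

/-- **Shard (S3).** In a module on which `t` acts injectively (no `t`-torsion — MEMO-11 (F4)), if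
`t^(k+1) • b = t • n` with `n ∈ N`, then `t^k • b ∈ N` (Theorem B: from `T_v·𝓑𝓕 ∈ T_v·H¹_{rel}(… 𝕃_{i-1} …)`
and no `T_v`-torsion, `𝓑𝓕 ∈ H¹_{rel}(… 𝕃_{i-1} …)`; iterate along the chain). -/
theorem descent_step {M : Type*} [AddCommGroup M] [Module R M] {t : R} (htor : ∀ x : M, t • x = 0 → x = 0)
    {N : Submodule R M} {b n : M} (hn : n ∈ N) {k : ℕ} (h : t ^ (k + 1) • b = t • n) : t ^ k • b ∈ N := by
  have h0 : t • (t ^ k • b - n) = 0 := by rw [smul_sub, ← mul_smul, ← pow_succ', h, sub_self]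
  rw [sub_eq_zero.1 (htor _ h0)]
  exact hn

end Summit.BirchSwinnertonDyer.BirchSwinnertonDyer.Theorems.SignLattices
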